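import Summits.AtomisticToContinuum.HydrodynamicLimit.Theses.AntiMazurCoboundaries
import Summits.AtomisticToContinuum.HydrodynamicLimit.Theorems.AntiMazurCoboundariesCellForecastPressureDecayEntropyBallObjects
import Summits.AtomisticToContinuum.HydrodynamicLimit.Theorems.CellForecastPressureDecay.Negative.PerParticle
import Summits.AtomisticToContinuum.HydrodynamicLimit.Theorems.ImplosionDichotomyHsEosLowDensity
import Literature.MathematicalPhysics.StatisticalMechanics.SpecificRelativeEntropy
import Literature.MathematicalPhysics.StatisticalMechanics.HardSphereGibbs
import Literature.Analysis.FluidPDE.InfiniteHardSphereDynamics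
import Literature.Analysis.FunctionSpaces.PointConfigFactorialMeasure

/-!
# Line `entropy-ball-invariant-states` — crux `AntiMazurCoboundaries.CellForecastPressureDecay`
(stmt-AtomisticToContinuum-13915, the N-free core of route AntiMazurCoboundaries)

LEAD'S SKELETON (line lead `prover-line-stmt-AtomisticToContinuum-13915-1`, 2026-08-16; picked line, see
`Cruxes/CellForecastPressureDecay/PICKED.md`). Changes w.r.t. the crux-plan g2 skeleton `98b41a1f1bfe`:
(L1) the provable finite-volume stub S2b is SPLIT into `stub_torusGibbsInvariant : TorusGibbsInvariance`
(Liouville + energy conservation: the torus canonical law is invariant under every torus hard-sphere flow;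
size S, pattern `Theorems.…map_flow_localGibbsLaw_const`) and
`stub_entropyBallDuality : TorusGibbsInvariance → EntropyBallDuality` (Donsker–Varadhan + K–B average +
Jensen; size M), so that two stub-workers can land them independently; (L2) the objects of §§ 1–3 are
being landed VERBATIM as the importable modules
`Theorems/AntiMazurCoboundariesCellForecastPressureDecayEntropyBall{Torus,State}Objects.lean` (namespace
`Summit.AtomisticToContinuum.HydrodynamicLimit.Theorems.EntropyBall`); until they are accepted this file
keeps its own copy (same text), afterwards the copies are replaced by `open …Theorems.EntropyBall`.
All other registered statements are unchanged.

Skeleton (crux-plan, round 1, generation-2 pass) of crux idea card `entropy-ball-invariant-states`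
(ideator 1, gen 2; triage r1-1 / r1-2 / r1-3: pass). This file SUPERSEDES the first crux-plan pass
on the same card (skeleton `784f843ea3bc`, 6 stubs); what changed and why is recorded in § 0 below
and in the line card `Lines/entropy-ball-invariant-states.md`.

THE LEVER (card). The crux's exponent `2c Σ_i Ξ_T(i)`, `Ξ_T(i) = T⁻¹∫₀ᵀ g(v^{fc}_i)` along the
`R`-local isolated-cluster FORECAST, is an additive, exactly `R`-local, bounded score of the
time-zero Gibbs field, so the pressure dualises EXACTLY against states (Donsker–Varadhan), and the
Krylov–Bogoliubov (Cesàro) average of a dual optimiser loses nothing by linearity (time-averaging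
the STATE = time-averaging the OBSERVABLE) while it can only lose entropy. The core therefore lands
on ONE time-free inequality for space-time invariant near-Gibbs states of the infinite dilute gas:
ONE-BODY ENTROPIC STIFFNESS `2ρ|⟨g, f₁^ν⟩| ≤ (free-energy deficit of ν)` (`stub_oneBodyEntropicStiffness`,
the card's C⁺, the only open stub).

## § 0 What this pass changed w.r.t. skeleton `784f843ea3bc` (same slug), and why

1. `stub_diniTransfer` / `PointwiseCore` / `DiniTransfer` are GONE (5 stubs instead of 6). The
   Krylov–Bogoliubov closure (S3) and the duality (S2b) were already uniform in the particle
   number `n ≤ 2Λ³` and the tilt `|c'| ≤ 2`; only the cell→torus reduction (S2a) had been stated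
   with `ρ, c` fixed first and `n = ⌊ρL³⌋₊`, for no reason intrinsic to its proof (embedding +
   surface free energy + Hölder + S4 are uniform in `n ≤ 2L³`). S2a is now uniform, and the
   sorry-free composition `uniformCore_of_parts` reaches the crux body directly: no Dini argument,
   no two-sided cell↔torus comparison, no add-one-particle Lipschitz lemma is needed anywhere.
2. FORECAST-STATIONARITY IS CAPPED (`IsForecastStationary`: `E_ν[fc_R ∧ N] → E_ν[static ∧ N]`
   for every cap `N`). Forecasts of different particles come from DIFFERENT isolated cluster
   dynamics, so forecast positions need not be jointly hard-core: in the uncapped `k`-tuple sums a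
   single bad particle can spoil unboundedly many tuples (pile-ups of wrong forecasts), and the
   transfer bound "defect ≤ C_{r,k}·(density of bad particles)" claimed for S3 fails for `k ≥ 2`
   (the crude bound grows like `R^{3k}` while the admissible tilt `lam` is tied to `R ≥ R₀(s,lam)`).
   With the cap, `|fc_R ∧ N − static∘Φ_s ∧ N| ≤ N·𝟙{some bad particle or jumper is (forecast or
   truly) in B̄(0,r) at time s}`, whose translation average is `≤ N·|B_r|·(density of bad +
   jumpers)` — LINEAR, so the entropy-inequality transfer works at every order `k`. The cap is
   invisible for honest states: `static ≤ P_r^k` by hard-core packing, and for a tempered state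
   carried by a LOCAL infinite-volume flow the capped notion is EQUIVALENT to invariance (a.s.
   eventual agreement of forecasts + dominated convergence — which needs the cap — + the fact that
   factorial moment measures of all orders of a hard-core marked point field determine its law).
3. THE ENTROPY CURRENCY OF C⁺ IS INTRINSIC: the free-energy DEFICIT
   `𝓘_σ(ν) = h(ν | Π_ρ) − ρ·F(ρσ³)` (`Π_ρ` = ideal gas = Poisson field of intensity
   `ρ·Leb ⊗ N(0,I)`, `F = hsExcessFreeEnergy`, the excess free energy per particle of hard spheres,
   `ρ = ρ_ν`), instead of `h(ν | P*)` for a DLR Gibbs state `P*` of matching intensity. Classically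
   `𝓘_σ(ν) = h(ν | P*)` (Gibbs variational principle; `𝓘 ≥ 0`, `= 0` iff `ν` is the Gibbs state),
   so C⁺ is the same statement for the stiffness prover; but the TRUE-grade closure S3 no longer
   has to produce `P*` (existence of translation-invariant low-activity Gibbs states of PRESCRIBED
   density — route item `RelEntropyErgodic.LowActivityGibbsState`, unproved, route retired) nor
   the DLR half of the variational identity, and Poisson superadditivity (false for the canonical
   reference) becomes available: `KL(μ | G_Λ) = KL(μ | π_Λ) + log Z'_Λ` with `π_Λ` = i.i.d.
   uniform ⊗ Maxwellian particles and `Z'_Λ = hsFreeVolume (ρσ³) n` — whose thermodynamic limit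
   `−n⁻¹ log hsFreeVolume η n → F(η)` is PROVED in the tree
   (`Theorems.hsEosLowDensity_proof : ImplosionDichotomy.HsEosLowDensity`, imported above). The
   same theorem disposes of S2a's partition-function ratio
   (`Z^E_cube(n,L) ≥ Z^T_torus(n,L)`, so `G(A) ≥ (L/(L+σ))^{3n}·FV(η₁,n)/FV(η₂,n) = e^{−o(L³)}` by
   monotone ⇒ locally uniform convergence of `−n⁻¹ log FV(·, n)` to the continuous `F`).
4. S4 (`TorusInfluenceLocality`), S2b (`EntropyBallDuality`), the statement of S3
   (`KrylovBogoliubovClosure`) and all frames are kept VERBATIM (their registered signatures do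
   not change). S4 is NOT literally route item 13916 (`InfluenceLocality` lets `σ₀` depend on the
   density parameter `a`; S4 is uniform over `n ≤ 2Λ³` and monotone in `R`) — it stays a stub.

## How the skeleton cuts the crux

* TEMPEREDNESS IS NOT AN ENTROPY-BALL PROPERTY (card falsifier (ii); triage r1-1 (v), r1-3 (b)):
  finite specific entropy allows fast particles of intensity `≍ h/V²`, whose influx from far away is
  not summable, so Alexander's flow is undefined on entropy-ball states. Hence C⁺ is typed over the
  DYNAMICS-FREE invariance notion `IsForecastStationary` (capped, § 0.2): every `k`-body local
  observable evaluated on the range-`R` isolated-cluster forecasts of the tree (`localClusterState`,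
  enumerations averaged through `PointConfig.factorialMeasure`) has, in the limit `R → ∞`, its
  static expectation, at every horizon and every cap. No `∀ Φ : InfiniteHardSphereFlow` and no
  named Alexander fact appears anywhere (triage note 3).
* KRYLOV–BOGOLIUBOV RUNS IN FINITE VOLUME, where it is exact convex analysis: on the unit torus
  (`n` spheres of diameter `σ/Λ`, canonical law `torusGibbs`, flow-invariant)
  `∫⁻ e^{τ⁻¹∫₀^τ f∘Φ_t} dG ≤ exp(E_μ f − KL(μ|G))` for a `(2s/τ)`-almost invariant `μ ≪ G` with
  `KL(μ|G) ≤ 2‖f‖∞` (`stub_entropyBallDuality`, provable now). The GLOBAL finite-volume entropy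
  inequality plus Jensen-in-time under the invariant `G` transfer EQUILIBRIUM large-deviation
  locality (`stub_influenceLocality`) to `μ` uniformly in `T` — this is what makes local limits
  forecast-stationary with no temperedness (`stub_kbClosure`: local limits, Poisson superadditivity
  + lower semicontinuity of relative entropy, the PROVED equation of state, continuity of the
  one-body bias; Stiffness then bounds the torus dual value).
* `stub_torusReduction`: cell (free b.c., Euclidean forecasts) → torus of side `Λ ∈ [L, 2L]`
  (periodic, true dynamics), uniformly in `n ≤ 2L³` and `|c| ≤ 1`: embed the cube in the torus of
  side `L + σ` (the cell law IS the torus law conditioned on "all particles in the cube", an event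
  of probability `≥ e^{−o(L³)}` by § 0.3), boundary layer `O(RL²/σ³)`, forecast → true by Hölder and
  `stub_influenceLocality`; the Hölder tilt inflation `c ↦ c'`, `|c'| ≤ (1+ε)|c|`, is why
  `stub_kbClosure` is stated for `|c'| ≤ 2` with the bound `|c'|·KL + ηΛ³`.

Composition (sorry-free, this file): `uniformCore_of_parts : CellToTorusReduction →
EntropyBallDuality → KrylovBogoliubovClosure → UniformCore` (`UniformCore` = the crux body
verbatim; choices `η = δ/17`, `C₀ = 16κ`, `T = T₀(C₀, η)`, `ε = min(η/(16κ), 1)`, `σ₀ = min`, `κ`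
from the closure, `L₀ = max`), and `CellForecastPressureDecay_of : CellForecastPressureDecay` BY
NAME from the six registered stubs `stub_influenceLocality`, `stub_torusReduction`,
`stub_torusGibbsInvariant`, `stub_entropyBallDuality`, `stub_oneBodyEntropicStiffness`, `stub_kbClosure`.

Disproof used (`Cruxes/CellForecastPressureDecay/Disproof.lean`, cycle 1; landed Negative lemmas
imported above via `…Negative.PerParticle` ⊇ `LoneParticle` ⊇ `WithoutOrthogonality`, p74445 /
p73994 / p73681): `_false_without_orthogonality` (§2) is honoured at `stub_oneBodyEntropicStiffness`
— for the Gibbs state `ν = P_ρ` itself the deficit is `0` while `2|bias| = 2ρ|E_M g|`, so `g ⊥ 1`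
is used exactly there — AND at `stub_kbClosure` (for `μ = G` the conclusion reads
`2c' n E_M g ≤ ηΛ³`); `g ⊥ v, |v|²` with `∃κ` prices the thermal / drifted Gibbs states (§7
near-miss: deficit `ρ(3/2)(s − log(1+s))` vs gain `≤ Cκρs²`, stiff iff `κ < κ*`; both S1 and S3
carry `∃κ`); `_false_perParticle` (§6) — every statement is per VOLUME (`e^{δL³}`, `ηΛ³`, specific
entropy, the intensity factor `ρ` inside `oneBodyBias`), and the slack `ηΛ³` is what makes
`stub_kbClosure` true for `n = O(1)` (a lone particle keeps ANY velocity law, §3–4); §1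
(`isProbabilityMeasure_cellLaw`) is the cell frame. No stub is an instance of a landed Negative
lemma, and none integrates flow junk off good sets (all dynamical integrals are against
`torusGibbs`-absolutely-continuous laws or the crux's own cell law; the refutation pattern of
`BGEndpointRigidityLanfordEnvelope_refuted` does not apply).
-/

noncomputable section

open MeasureTheory ProbabilityTheory Set Filter Topology
open scoped ENNReal Classical

namespace Summit.AtomisticToContinuum.HydrodynamicLimit.Cruxes.CellForecastPressureDecay.EntropyBallInvariantStates

open Literature.MathematicalPhysics.KineticTheory (T3 V3 hsExcessFreeEnergy)
open Literature.Analysis.FunctionSpaces (PointConfig IsPoissonPointProcess)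
open Literature.Analysis.FluidPDE (HardSphereFlow Config localClusterState canonicalDensity particleLaw
  globalMaxwellian IsTranslationInvariant IsHardCore kineticEnergyDensity)
open Literature.MathematicalPhysics.StatisticalMechanics (specificRelativeEntropy HasFiniteSpecificEntropy
  unitCube intensity)
open Summit.AtomisticToContinuum.HydrodynamicLimit.Theses.AntiMazurCoboundaries (CellForecastPressureDecay)
open Summit.AtomisticToContinuum.HydrodynamicLimit.Theorems.TiltAnalyticity (Flows cellLaw)
open Summit.AtomisticToContinuum.HydrodynamicLimit.Theorems.EntropyBall

/-! ## 1–3. Frames, objects and stub statements: imported from the objects module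
`Theorems/AntiMazurCoboundariesCellForecastPressureDecayEntropyBallObjects.lean` (namespace
`Summit.AtomisticToContinuum.HydrodynamicLimit.Theorems.EntropyBall`, opened above). -/

/-- **UNIFORM CORE** — the body of the crux `AntiMazurCoboundaries.CellForecastPressureDecay`,
verbatim (a local name so that only `CellForecastPressureDecay_of` concludes the route decl). -/
def UniformCore : Prop :=
  ∃ σ₀ : ℝ, 0 < σ₀ ∧ ∀ σ : ℝ, 0 < σ → σ < σ₀ → ∃ κ : ℝ, 0 < κ ∧ ∀ g : Literature.MathematicalPhysics.KineticTheory.V3 → ℝ, Continuous g → (∀ v, |g v| ≤ κ) → (∀ (c₀ c₂ : ℝ) (b : Literature.MathematicalPhysics.KineticTheory.V3), ∫ v, g v * (c₀ + inner ℝ b v + c₂ * ‖v‖ ^ 2) ∂(ProbabilityTheory.stdGaussian Literature.MathematicalPhysics.KineticTheory.V3) = 0) → ∀ δ : ℝ, 0 < δ → ∃ T : ℝ, 0 < T ∧ ∃ R₀ : ℝ, 0 < R₀ ∧ ∀ R : ℝ, R₀ ≤ R → ∃ L₀ : ℝ, 0 < L₀ ∧ ∀ L : ℝ, L₀ ≤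 L → ∀ n : ℕ, (n : ℝ) ≤ 2 * L ^ 3 → ∀ (Ψ : (k : ℕ) → Literature.Analysis.FluidPDE.HardSphereFlow (Literature.Analysis.FluidPDE.Euclidean.geometry (Fin 3)) σ k) (c : ℝ), |c| ≤ 1 → ∫⁻ z, ENNReal.ofReal (Real.exp (2 * c * ∑ i : Fin n, T⁻¹ * ∫ t in (0 : ℝ)..T, g (Literature.Analysis.FluidPDE.localClusterState Ψ R t z i).2)) ∂(Literature.Analysis.FluidPDE.particleLaw (Ψ n) (Literature.Analysis.FluidPDE.canonicalDensity (Literature.Analysis.FluidPDE.Euclidean.geometry (Fin 3)) σ n (fun p => Set.indicator {x : Literature.MathematicalPhysics.KineticTheory.V3 | ∀ k, x k ∈ Set.Icc (0 : ℝ) L} (fun _ => (1 : ℝ)) p.1 * Literature.Analysis.FluidPDE.globalMaxwellian p.2))) ≤ ENNReal.ofReal (Real.exp (δ * L ^ 3))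

/-! ## 4. Registered stubs (the only `sorry`s of the line) -/

/-- STUB S0 — OBJECTS BOOKKEEPING (lead; closed by the objects module
`Theorems/AntiMazurCoboundariesCellForecastPressureDecayEntropyBallObjects.lean` once it lands): (i) read-back of
the cell functional as the crux's integral against the crux's measure; (ii) non-vacuity of the Poisson reference of
`OneBodyEntropicStiffness`; (iii) the pointwise bound on the torus score used by the composition. -/
theorem stub_objects :
    (∀ (σ : ℝ) (g : V3 → ℝ) (c T R L : ℝ) (n : ℕ) (Ψ : Flows σ),
      cellWindowPressure σ g c T R L n Ψ =
        ∫⁻ z, ENNReal.ofReal (Real.exp (2 * c * ∑ i : Fin n, T⁻¹ * ∫ t in (0 : ℝ)..T,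
          g (localClusterState Ψ R t z i).2))
          ∂(particleLaw (Ψ n) (canonicalDensity (Literature.Analysis.FluidPDE.Euclidean.geometry (Fin 3)) σ n
            (fun p => Set.indicator {x : V3 | ∀ k, x k ∈ Set.Icc (0 : ℝ) L} (fun _ => (1 : ℝ)) p.1 *
              globalMaxwellian p.2)))) ∧
    (∀ ρ : ℝ, ∃ P : Measure (PointConfig (V3 × V3)), IsPoissonPointProcess (idealGasIntensity ρ) P) ∧
    (∀ (g : V3 → ℝ) (κ : ℝ), (∀ v, |g v| ≤ κ) → ∀ (c' : ℝ) (n : ℕ) (z : TorusPhase n),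
      |fluxSum g c' n z| ≤ 2 * |c'| * (n * κ)) :=
  -- CLOSED: landed in the objects module
  Summit.AtomisticToContinuum.HydrodynamicLimit.Theorems.EntropyBall.stub_objects

/-- STUB S4 (size M/L; TRUE-grade — the sibling of route crux InfluenceLocality
stmt-AtomisticToContinuum-13916 in the cell scaling, uniform over densities `≤ 2`).
Sources: Alexander1976, MarchioroPellegrinottiPresutti1975, CagliotiMarchioroPulvirenti2000,
DobrushinFritz1977, Sinai1972, Spohn1991 Thm 1.2; triage r1-2 / r1-3 cross-cutting notes (LD cone
`R₀(T)` super-linear but finite in this quantifier order); `Cruxes/InfluenceLocality/Disproof.lean`. -/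
theorem stub_influenceLocality : TorusInfluenceLocality := by
  sorry

/-- STUB S2a (size L; TRUE-grade: embedding + free-volume ratio via the PROVED equation of state +
static boundary layer + Hölder + S4). Sources: Ruelle1969 §3.4, PulvirentiTsagkarogiannis2012,
`Theorems.hsEosLowDensity_proof` (PROVED), `HardSphereFlow.nonempty_torus_holds` (PROVED,
`0 < ε < 1/2`), `HardSphereUniqueness`, `HardSphereEuclideanTransfer`, Disproof §1. -/
theorem stub_torusReduction : TorusInfluenceLocality → CellToTorusReduction := by
  sorry

/-- STUB S2b-ii (size M; TRUE, provable now — Donsker–Varadhan + Fubini + convexity of KL, GIVEN the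
invariance of the torus canonical law `TorusGibbsInvariance` = stub S2b-i). Sources: KipnisLandim1999 App. 1 §8 (entropy variational
formula, `Literature.Probability.Entropy.KipnisLandim1999_A1_8_2` PROVED), DemboZeitouni2010 §6.2
(Donsker–Varadhan), OllaVaradhanYau1993 §4 (A)–(E) (the K–B + entropy prototype), Mathlib
`InformationTheory.klDiv`, `MeasureTheory.Measure.tilted`, `HardSphereFlow.measurePreserving`,
`HardSphereFlow.aemeasurable_intervalIntegral_comp_flow_torus`; route support HomogeneousInvariance
(stmt-9621) is the `localGibbsLaw` twin of the invariance used. -/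
theorem stub_entropyBallDuality : TorusGibbsInvariance → EntropyBallDuality := by
  sorry

/-- STUB S2b-i (size S; TRUE, provable now — lead's split of S2b): the torus canonical Gibbs law is
invariant under every torus hard-sphere flow (Liouville `HardSphereFlow.measurePreserving` + energy
conservation `HardSphereFlow.configEnergy_flow` on the conull good set; pattern
`Theorems.BoltzmannGreenKuboOrthMomentum.map_flow_localGibbsLaw_const`). -/
theorem stub_torusGibbsInvariant : TorusGibbsInvariance := by
  sorry

/-- STUB S1 (size XL; OPEN — the HARDEST: the whole open content of the crux in time-free form; by the
card's `CheapStateRefutes` a single cheap forecast-stationary state refutes 13915, 10967 and X at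
once). Sources: OllaVaradhanYau1993 §4, GurevichSuhov1976, GenoveseSimonella2012 §1, Spohn1991 Part I
§2.4, NachtergaeleYau2003 §2.3, LiveraniOlla1996 Thm 1.2, FritzFunakiLebowitz1994, GeorgiiZessin1993
§2.3 / Thm 3.3 (variational principle: deficit = entropy relative to Gibbs), BarangerMouhot2005
(PROVED gap `le_neg_maxwellianInner_hardSphereLinearizedOp_of_orthogonal_holds`),
Literature.Barriers.AtomisticToContinuum.BoltzmannHypothesisBarrierNarrow (caveat (b)),
MazurBoundBallisticNarrow (4)–(5). -/
theorem stub_oneBodyEntropicStiffness : OneBodyEntropicStiffness := by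
  sorry

/-- STUB S3 (size L; TRUE-grade GIVEN its two antecedents — local limits of blown-up torus states,
Poisson superadditivity + lower semicontinuity of relative entropy, the PROVED hard-sphere equation
of state for `log Z'`, continuity of the one-body bias, capped forecast-stationarity of K–B limits
by the global entropy inequality). Sources: GeorgiiZessin1993 §2.3 + Prop. 2.6, Georgii1994 Thm 1,
Ruelle1969 §3.4 / §7.2, OllaVaradhanYau1993 Lemma 4.1–4.2, Kifer1990,
`Literature.Probability.Entropy.KipnisLandim1999_A1_8_2` (entropy inequality, PROVED),
`Literature.Analysis.FluidPDE.localLaw` / `measurable_localConfig` (PROVED),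
`Theorems.hsEosLowDensity_proof` (PROVED), `Literature.Analysis.FunctionSpaces.IsPoissonPointProcess`
API (`iIndepFun_count`, existence/uniqueness PROVED),
`Literature.MathematicalPhysics.StatisticalMechanics.GeorgiiZessin1993_specificEntropy` (PROVED `_holds`). -/
theorem stub_kbClosure :
    TorusInfluenceLocality → OneBodyEntropicStiffness → KrylovBogoliubovClosure := by
  sorry

/-! ## 5. Composition (real proofs; no `sorry` below this line) -/

/-- **The crux body from the reduction, the duality and the closure** (quantifier bookkeeping +
two lines of arithmetic: `η = δ/17`, `C₀ = 16κ`, `T = T₀`, `ε = min(η/(16κ), 1)`; the torus has side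
`Λ ∈ [L, 2L]`, so `log(cell functional) ≤ ηL³ + (|c'| − 1)·KL + ηΛ³ ≤ ηL³ + 2ηΛ³ ≤ 17ηL³ = δL³`).
Uniform in `n ≤ 2L³` and `|c| ≤ 1` because all three parts are. -/
theorem uniformCore_of_parts (hA : CellToTorusReduction) (hB : EntropyBallDuality)
    (hC : KrylovBogoliubovClosure) : UniformCore := by
  obtain ⟨σA, hσA, HA⟩ := hA
  obtain ⟨σC, hσC, HC⟩ := hC
  refine ⟨min σA σC, lt_min hσA hσC, fun σ hσ hσlt => ?_⟩
  have hσA' : σ < σA := lt_of_lt_of_le hσlt (min_le_left _ _)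
  have hσC' : σ < σC := lt_of_lt_of_le hσlt (min_le_right _ _)
  obtain ⟨κ, hκ, HCκ⟩ := HC σ hσ hσC'
  refine ⟨κ, hκ, fun g hg hgκ horth δ hδ => ?_⟩
  -- parameters
  set η : ℝ := δ / 17 with hηdef
  have hη : 0 < η := by positivity
  set C₀ : ℝ := 16 * κ with hC₀def
  have hC₀ : 0 < C₀ := by positivity
  obtain ⟨T₀, hT₀, HT⟩ := HCκ g hg hgκ horth C₀ hC₀ η hη
  set ε : ℝ := min (η / (16 * κ)) 1 with hεdef
  have hε : 0 < ε := lt_min (by positivity) one_pos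
  have hε1 : ε ≤ 1 := min_le_right _ _
  have hεη : ε * (16 * κ) ≤ η := by
    have : ε ≤ η / (16 * κ) := min_le_left _ _
    calc ε * (16 * κ) ≤ η / (16 * κ) * (16 * κ) := mul_le_mul_of_nonneg_right this (by positivity)
      _ = η := div_mul_cancel₀ _ (by positivity)
  obtain ⟨R₀, hR₀, HR⟩ := HA σ hσ hσA' κ hκ g hg hgκ T₀ hT₀ η hη ε hε
  refine ⟨T₀, hT₀, R₀, hR₀, fun R hR => ?_⟩
  obtain ⟨La, hLa, HLa⟩ := HR R hR
  obtain ⟨Lc, hLc, HLc⟩ := HT T₀ le_rfl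
  refine ⟨max (max La Lc) 1, lt_of_lt_of_le one_pos (le_max_right _ _), fun L hL n hn Ψ c hc => ?_⟩
  have hLa' : La ≤ L := (le_max_left _ _).trans ((le_max_left _ _).trans hL)
  have hLc' : Lc ≤ L := (le_max_right _ _).trans ((le_max_left _ _).trans hL)
  have hL1 : 1 ≤ L := (le_max_right _ _).trans hL
  have hL0 : 0 < L := lt_of_lt_of_le one_pos hL1
  have hL3 : 0 ≤ L ^ 3 := pow_nonneg hL0.le 3
  -- step A: cell → torus of side Λ ∈ [L, 2L]
  obtain ⟨Λ, hLΛ, hΛ2L, Φ, c', hGprob, hc', hcell⟩ := HLa L hLa' n hn Ψ c hc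
  have hΛ0 : 0 < Λ := lt_of_lt_of_le hL0 hLΛ
  have hΛ3 : 0 ≤ Λ ^ 3 := pow_nonneg hΛ0.le 3
  have hΛ3le : Λ ^ 3 ≤ 8 * L ^ 3 := by
    calc Λ ^ 3 ≤ (2 * L) ^ 3 := pow_le_pow_left₀ hΛ0.le hΛ2L 3
      _ = 8 * L ^ 3 := by ring
  have hL3Λ3 : L ^ 3 ≤ Λ ^ 3 := pow_le_pow_left₀ hL0.le hLΛ 3
  have hnΛ : (n : ℝ) ≤ 2 * Λ ^ 3 := by linarith
  have hc'1 : |c'| ≤ 1 + ε := by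
    calc |c'| ≤ (1 + ε) * |c| := hc'
      _ ≤ (1 + ε) * 1 := mul_le_mul_of_nonneg_left hc (by positivity)
      _ = 1 + ε := mul_one _
  have hc'2 : |c'| ≤ 2 := by linarith
  -- step B: duality on the torus with f = fluxSum g c' n, C = 8 κ Λ³, τ = T₀ / Λ
  have hfb : ∀ z, |fluxSum g c' n z| ≤ 8 * κ * Λ ^ 3 := by
    intro z
    calc |fluxSum g c' n z| ≤ 2 * |c'| * ((n : ℝ) * κ) := abs_fluxSum_le hgκ c' _ z
      _ ≤ 2 * 2 * (2 * Λ ^ 3 * κ) := by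
          apply mul_le_mul (mul_le_mul_of_nonneg_left hc'2 (by norm_num))
            (mul_le_mul_of_nonneg_right hnΛ hκ.le) (by positivity) (by positivity)
      _ = 8 * κ * Λ ^ 3 := by ring
  have hτ : 0 < T₀ / Λ := div_pos hT₀ hΛ0
  have hσΛ : 0 < σ / Λ := div_pos hσ hΛ0
  obtain ⟨μ, hμP, hμac, hKL, hAI, hdual⟩ :=
    hB (σ / Λ) n Φ hσΛ hGprob (fluxSum g c' n) (measurable_fluxSum hg c' _) (8 * κ * Λ ^ 3) hfb
      (T₀ / Λ) hτ
  -- step C: the closure bounds the dual value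
  have hKL' : InformationTheory.klDiv μ (torusGibbs (σ / Λ) n Φ) ≤ ENNReal.ofReal (C₀ * Λ ^ 3) := by
    refine hKL.trans (le_of_eq ?_)
    congr 1
    rw [hC₀def]; ring
  have hAI' : ∀ s : ℝ, 0 ≤ s → ∀ B : Set (TorusPhase n), MeasurableSet B →
      |(μ (Φ.flow s ⁻¹' B)).toReal - (μ B).toReal| ≤ 2 * s * Λ / T₀ := by
    intro s hs B hB'
    have h := hAI s hs B hB'
    rwa [div_div_eq_mul_div] at h
  have hΛc : Lc ≤ Λ := hLc'.trans hLΛ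
  have hclos := HLc Λ hΛc n hnΛ Φ μ hGprob hμP hμac hKL' hAI' c' hc'2
  -- arithmetic: ∫ f dμ − KL ≤ (|c'| − 1) KL + η Λ³ ≤ ε · 16 κ Λ³ + η Λ³ ≤ 2 η Λ³ ≤ 16 η L³
  have hKL0 : 0 ≤ (InformationTheory.klDiv μ (torusGibbs (σ / Λ) n Φ)).toReal :=
    ENNReal.toReal_nonneg
  have hKLle : (InformationTheory.klDiv μ (torusGibbs (σ / Λ) n Φ)).toReal ≤ 16 * κ * Λ ^ 3 := by
    have h := ENNReal.toReal_mono ENNReal.ofReal_ne_top hKL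
    rw [ENNReal.toReal_ofReal (by positivity)] at h
    calc (InformationTheory.klDiv μ (torusGibbs (σ / Λ) n Φ)).toReal ≤ 2 * (8 * κ * Λ ^ 3) := h
      _ = 16 * κ * Λ ^ 3 := by ring
  have hexp : ∫ z, fluxSum g c' n z ∂μ -
      (InformationTheory.klDiv μ (torusGibbs (σ / Λ) n Φ)).toReal ≤ 16 * η * L ^ 3 := by
    have h2 : (|c'| - 1) * (InformationTheory.klDiv μ (torusGibbs (σ / Λ) n Φ)).toReal ≤
        ε * (16 * κ * Λ ^ 3) := by
      calc (|c'| - 1) * (InformationTheory.klDiv μ (torusGibbs (σ / Λ) n Φ)).toReal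
          ≤ ε * (InformationTheory.klDiv μ (torusGibbs (σ / Λ) n Φ)).toReal :=
            mul_le_mul_of_nonneg_right (by linarith) hKL0
        _ ≤ ε * (16 * κ * Λ ^ 3) := mul_le_mul_of_nonneg_left hKLle hε.le
    have h3 : ε * (16 * κ * Λ ^ 3) ≤ η * Λ ^ 3 := by
      calc ε * (16 * κ * Λ ^ 3) = ε * (16 * κ) * Λ ^ 3 := by ring
        _ ≤ η * Λ ^ 3 := mul_le_mul_of_nonneg_right hεη hΛ3
    have h4 : η * Λ ^ 3 ≤ 8 * η * L ^ 3 := by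
      calc η * Λ ^ 3 ≤ η * (8 * L ^ 3) := mul_le_mul_of_nonneg_left hΛ3le hη.le
        _ = 8 * η * L ^ 3 := by ring
    linarith [hclos, h2, h3, h4]
  have hI : torusExpMoment (σ / Λ) n Φ (fluxSum g c' n) (T₀ / Λ) ≤
      ENNReal.ofReal (Real.exp (16 * η * L ^ 3)) :=
    hdual.trans (ENNReal.ofReal_le_ofReal (Real.exp_le_exp.2 hexp))
  have hone : (1 : ℝ≥0∞) ≤ ENNReal.ofReal (Real.exp (16 * η * L ^ 3)) := by
    rw [← ENNReal.ofReal_one]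
    exact ENNReal.ofReal_le_ofReal (Real.one_le_exp (by positivity))
  have hsup : (1 : ℝ≥0∞) ⊔ torusExpMoment (σ / Λ) n Φ (fluxSum g c' n) (T₀ / Λ) ≤
      ENNReal.ofReal (Real.exp (16 * η * L ^ 3)) := sup_le hone hI
  -- assemble
  calc cellWindowPressure σ g c T₀ R L n Ψ
      ≤ ENNReal.ofReal (Real.exp (η * L ^ 3)) *
          ((1 : ℝ≥0∞) ⊔ torusExpMoment (σ / Λ) n Φ (fluxSum g c' n) (T₀ / Λ)) := hcell
    _ ≤ ENNReal.ofReal (Real.exp (η * L ^ 3)) * ENNReal.ofReal (Real.exp (16 * η * L ^ 3)) :=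
        mul_le_mul' le_rfl hsup
    _ = ENNReal.ofReal (Real.exp (δ * L ^ 3)) := by
        rw [← ENNReal.ofReal_mul (Real.exp_pos _).le, ← Real.exp_add]
        congr 2
        rw [hηdef]; ring

/-- **The skeleton concludes the crux BY NAME.** `CellForecastPressureDecay` (route
`AntiMazurCoboundaries`, stmt-AtomisticToContinuum-13915) from the six registered stubs: influence
locality (S4) feeds the torus reduction (S2a) and the Krylov–Bogoliubov closure (S3), which with the
exact entropy-ball duality (S2b) and one-body entropic stiffness (S1) give the crux body, uniformly
in the particle number and the tilt. -/
theorem CellForecastPressureDecay_of : CellForecastPressureDecay :=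
  uniformCore_of_parts (stub_torusReduction stub_influenceLocality)
    (stub_entropyBallDuality stub_torusGibbsInvariant)
    (stub_kbClosure stub_influenceLocality stub_oneBodyEntropicStiffness)

end Summit.AtomisticToContinuum.HydrodynamicLimit.Cruxes.CellForecastPressureDecay.EntropyBallInvariantStates

end
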